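import Mathlib
import Summits.MatrixMultiplication.MatrixMultiplication.Theorems.LieRankDesigns.Negative.Basics
import Summits.MatrixMultiplication.MatrixMultiplication.Theorems.SubgroupIdentityDesigns.Negative.LeviCollision

/-!
# Levi collision, part 2: collision pairs exist for `2k ≤ r`; crux form for the rigid pair
(negative-lemma support for the crux `SubgroupIdentityDesigns`, stmt-MatrixMultiplication-14079; line
`levi-free-rigid-outer-pieces`, stub `stub_rigidDesigns`, milestone M1)

* `exists_leviCollision_pair`: if `2k ≤ r` then for EVERY `r × r` matrix `D` there are a right-invertible
  `γ ∈ M_{k×r}` and a left-invertible `β ∈ M_{r×k}` with `γ D β = 0` (`β` = coordinate embedding, `γ` = `k`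
  independent rows in the annihilator of `Col(Dβ)`, which has dimension `≥ r - k ≥ k`).
* `rigidPair_no_idTest_of_leviCollision`: for subgroups `H₁, H₃ ≤ GL_{k+r}(𝔽_p)` satisfying the LOWER / UPPER
  membership predicates of the rigid pair of the skeleton `Cruxes/SubgroupIdentityDesigns/Lines/
  levi_free_rigid_outer_pieces.lean` (verbatim, `Fin.castAdd`/`Fin.natAdd` coordinates) with tori `T₁, T₃`, a
  collision `γ (t₁t₃ - 1) β = 0` (`t_i ∈ T_i`, `t₁t₃ ≠ 1`) excludes the identity-test clause of the crux for EVERY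
  middle group `H₂` — by transporting `Negative.LeviCollision.no_idTest_of_leviCollision` along
  `finSumFinEquiv : Fin k ⊕ Fin r ≃ Fin (k + r)` (`[[1,0],[X,t₁]]·[[1,Z],[0,t₃]] = g(X,t₁t₃,Z)` lies in `H₁H₃`).
* `rigidPair_no_idTest_of_le`: hence if `2k ≤ r` and `T₁ ≠ 1`, the rigid pair carries NO level-`k` identity test
  whatever `H₂`: in the parametrisation of `stub_rigidDesigns` (`k = 2ℓ`, `r = ℓn`, `|T₁| ≥ p^{ℓ-1} ≥ 2`) every
  witness has `n ≤ 3`; the idea card's regime `n ≥ 2k` is dead.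
-/

set_option linter.dupNamespace false

noncomputable section

open scoped BigOperators
open Matrix

namespace Summit.MatrixMultiplication.MatrixMultiplication.Theorems.SubgroupIdentityDesigns.Negative

section Existence

variable {F : Type*} [Field F]

/-- Zero-padding `F^k → F^d` (`k ≤ d`). -/
def padLin (F : Type*) [Field F] {k d : ℕ} (_h : k ≤ d) : (Fin k → F) →ₗ[F] (Fin d → F) where
  toFun v j := if h : (j : ℕ) < k then v ⟨j, h⟩ else 0
  map_add' v w := by funext j; by_cases h : (j : ℕ) < k <;> simp [h]
  map_smul' c v := by funext j; by_cases h : (j : ℕ) < k <;> simp [h]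

/-- Truncation `F^d → F^k` (`k ≤ d`), a left inverse of the padding. -/
def cutLin (F : Type*) [Field F] {k d : ℕ} (h : k ≤ d) : (Fin d → F) →ₗ[F] (Fin k → F) :=
  LinearMap.funLeft F F (Fin.castLE h)

/-- `cut ∘ pad = id`. -/
theorem cutLin_comp_padLin {k d : ℕ} (h : k ≤ d) : cutLin F h ∘ₗ padLin F h = LinearMap.id := by
  apply LinearMap.ext
  intro v
  funext i
  simp [cutLin, padLin, LinearMap.funLeft_apply, Fin.castLE, i.isLt]

/-- An injective linear map `φ : F^k → F^r` with a left inverse gives a matrix `γ` (rows `φ(e_i)`) with a right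
inverse; if moreover `φ` lands in `{v : v A = 0}` then `γ A = 0`. -/
theorem exists_rightInv_of_leftInverse {k r l : ℕ} (φ : (Fin k → F) →ₗ[F] (Fin r → F))
    (ψ : (Fin r → F) →ₗ[F] (Fin k → F)) (hψ : ψ ∘ₗ φ = LinearMap.id) (A : Matrix (Fin r) (Fin l) F)
    (hA : ∀ v, φ v ᵥ* A = 0) :
    ∃ (γ : Matrix (Fin k) (Fin r) F) (γ' : Matrix (Fin r) (Fin k) F), γ * γ' = 1 ∧ γ * A = 0 := by
  refine ⟨(LinearMap.toMatrix' φ)ᵀ, (LinearMap.toMatrix' ψ)ᵀ, ?_, ?_⟩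
  · rw [← Matrix.transpose_mul, ← LinearMap.toMatrix'_comp, hψ, LinearMap.toMatrix'_id, Matrix.transpose_one]
  · ext i j
    have h := congrFun (hA (Pi.single i 1)) j
    simp only [Matrix.vecMul, dotProduct, Pi.zero_apply] at h
    rw [Matrix.mul_apply, Matrix.zero_apply, ← h]
    refine Finset.sum_congr rfl fun l _ => ?_
    rw [Matrix.transpose_apply, LinearMap.toMatrix'_apply]

/-- **Collision pairs exist for `2k ≤ r`.**  For every `r × r` matrix `D` there are `γ` (`k × r`, right
invertible) and `β` (`r × k`, left invertible) with `γ D β = 0`: take `β` the coordinate embedding and `γ` with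
`k` independent rows in the annihilator of `Col(Dβ)` (dimension `≥ r - k ≥ k`). -/
theorem exists_leviCollision_pair {k r : ℕ} (hkr : 2 * k ≤ r) (D : Matrix (Fin r) (Fin r) F) :
    ∃ (γ : Matrix (Fin k) (Fin r) F) (β : Matrix (Fin r) (Fin k) F) (γ' : Matrix (Fin r) (Fin k) F)
      (β' : Matrix (Fin k) (Fin r) F), γ * γ' = 1 ∧ β' * β = 1 ∧ γ * D * β = 0 := by
  have hkr' : k ≤ r := by omega
  -- `β`: the coordinate embedding, `β' β = 1`
  set β : Matrix (Fin r) (Fin k) F := LinearMap.toMatrix' (padLin F hkr') with hβ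
  set β' : Matrix (Fin k) (Fin r) F := LinearMap.toMatrix' (cutLin F hkr') with hβ'
  have hββ : β' * β = 1 := by
    rw [hβ, hβ', ← LinearMap.toMatrix'_comp, cutLin_comp_padLin, LinearMap.toMatrix'_id]
  -- the annihilator `K` of the columns of `A = D β` has dimension `≥ r - k ≥ k`
  set A : Matrix (Fin r) (Fin k) F := D * β with hA
  set L : (Fin r → F) →ₗ[F] (Fin k → F) := A.vecMulLinear with hL
  set K : Submodule F (Fin r → F) := LinearMap.ker L with hK
  have hdim : k ≤ Module.finrank F K := by
    have h1 : Module.finrank F (LinearMap.range L) + Module.finrank F K = r := by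
      rw [hK]
      simpa using LinearMap.finrank_range_add_finrank_ker L
    have h2 : Module.finrank F (LinearMap.range L) ≤ k := by
      calc Module.finrank F (LinearMap.range L) ≤ Module.finrank F (Fin k → F) := Submodule.finrank_le _
        _ = k := Module.finrank_fin_fun F
    omega
  -- an injective `φ : F^k → K ≤ F^r` with a left inverse
  set d := Module.finrank F K with hd
  let eK : K ≃ₗ[F] (Fin d → F) := LinearEquiv.ofFinrankEq K (Fin d → F) (by simp [hd])
  let φ : (Fin k → F) →ₗ[F] (Fin r → F) := K.subtype ∘ₗ eK.symm.toLinearMap ∘ₗ padLin F hdim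
  obtain ⟨ψK, hψK⟩ := K.subtype.exists_leftInverse_of_injective K.ker_subtype
  let ψ : (Fin r → F) →ₗ[F] (Fin k → F) := cutLin F hdim ∘ₗ eK.toLinearMap ∘ₗ ψK
  have hψ : ψ ∘ₗ φ = LinearMap.id := by
    apply LinearMap.ext
    intro v
    have h1 : ψK (K.subtype (eK.symm (padLin F hdim v))) = eK.symm (padLin F hdim v) :=
      LinearMap.congr_fun hψK _
    have h2 := LinearMap.congr_fun (cutLin_comp_padLin (F := F) hdim) v
    simp only [ψ, φ, LinearMap.coe_comp, Function.comp_apply, LinearEquiv.coe_coe] at h2 ⊢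
    rw [h1, LinearEquiv.apply_symm_apply, h2]
  have hφA : ∀ v, φ v ᵥ* A = 0 := by
    intro v
    have hmem : φ v ∈ K := (eK.symm (padLin F hdim v)).2
    rw [hK, LinearMap.mem_ker, hL, Matrix.vecMulLinear_apply] at hmem
    exact hmem
  obtain ⟨γ, γ', hγ, hγA⟩ := exists_rightInv_of_leftInverse φ ψ hψ A hφA
  exact ⟨γ, β, γ', β', hγ, hββ, by rw [Matrix.mul_assoc, ← hA, hγA]⟩

end Existence

section RigidPair

open Summit.MatrixMultiplication.MatrixMultiplication.Theorems.LieRankDesigns.Negative (GLm Mat fourierFn RankSupp)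

variable {p : ℕ} [Fact p.Prime] {k r : ℕ}

/-- The block matrix `[[1,0],[X,t]]` on `Fin (k + r)`. -/
def lowerMat (X : Matrix (Fin r) (Fin k) (ZMod p)) (t : Mat p r) : Mat p (k + r) :=
  Matrix.reindex finSumFinEquiv finSumFinEquiv (Matrix.fromBlocks 1 0 X t)

/-- The block matrix `[[1,Z],[0,t]]` on `Fin (k + r)`. -/
def upperMat (Z : Matrix (Fin k) (Fin r) (ZMod p)) (t : Mat p r) : Mat p (k + r) :=
  Matrix.reindex finSumFinEquiv finSumFinEquiv (Matrix.fromBlocks 1 Z 0 t)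

/-- `det [[1,0],[X,t]] = det t`. -/
theorem det_lowerMat (X : Matrix (Fin r) (Fin k) (ZMod p)) (t : Mat p r) : (lowerMat X t).det = t.det := by
  rw [lowerMat, Matrix.det_reindex_self, Matrix.det_fromBlocks_zero₁₂, Matrix.det_one, one_mul]

/-- `det [[1,Z],[0,t]] = det t`. -/
theorem det_upperMat (Z : Matrix (Fin k) (Fin r) (ZMod p)) (t : Mat p r) : (upperMat Z t).det = t.det := by
  rw [upperMat, Matrix.det_reindex_self, Matrix.det_fromBlocks_zero₂₁, Matrix.det_one, one_mul]

/-- `[[1,0],[X,t]]` as an element of `GL_{k+r}(𝔽_p)` (`t ∈ GL_r`). -/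
def lowerGL (X : Matrix (Fin r) (Fin k) (ZMod p)) (t : GLm p r) : GLm p (k + r) :=
  Matrix.GeneralLinearGroup.mkOfDetNeZero (lowerMat X (t : Mat p r))
    (by rw [det_lowerMat]; exact (Matrix.GeneralLinearGroup.det t).ne_zero)

/-- `[[1,Z],[0,t]]` as an element of `GL_{k+r}(𝔽_p)` (`t ∈ GL_r`). -/
def upperGL (Z : Matrix (Fin k) (Fin r) (ZMod p)) (t : GLm p r) : GLm p (k + r) :=
  Matrix.GeneralLinearGroup.mkOfDetNeZero (upperMat Z (t : Mat p r))
    (by rw [det_upperMat]; exact (Matrix.GeneralLinearGroup.det t).ne_zero)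

/-- `[[1,0],[X,t₁]] · [[1,Z],[0,t₃]] = g(X, t₁t₃, Z)` transported to `Fin (k + r)`. -/
theorem lowerGL_mul_upperGL (X : Matrix (Fin r) (Fin k) (ZMod p)) (Z : Matrix (Fin k) (Fin r) (ZMod p))
    (t₁ t₃ : GLm p r) :
    ((lowerGL X t₁ * upperGL Z t₃ : GLm p (k + r)) : Mat p (k + r)) =
      Matrix.reindex finSumFinEquiv finSumFinEquiv (blockPt X ((t₁ * t₃ : GLm p r) : Mat p r) Z) := by
  rw [Units.val_mul]
  change lowerMat X (t₁ : Mat p r) * upperMat Z (t₃ : Mat p r) = _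
  rw [lowerMat, upperMat, Matrix.reindex_apply, Matrix.reindex_apply, Matrix.submatrix_mul_equiv,
    Matrix.fromBlocks_multiply, Matrix.reindex_apply, blockPt, Units.val_mul]
  congr 1
  simp

omit [Fact p.Prime] in
/-- Entries of a reindexed block matrix at `castAdd`/`natAdd` positions. -/
theorem reindex_apply_castAdd_castAdd (B : Matrix (Fin k ⊕ Fin r) (Fin k ⊕ Fin r) (ZMod p)) (i j : Fin k) :
    Matrix.reindex finSumFinEquiv finSumFinEquiv B (Fin.castAdd r i) (Fin.castAdd r j) = B (Sum.inl i) (Sum.inl j) := by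
  simp [Matrix.reindex_apply]

omit [Fact p.Prime] in
/-- Entry `(castAdd i, natAdd j)` of a reindexed block matrix. -/
theorem reindex_apply_castAdd_natAdd (B : Matrix (Fin k ⊕ Fin r) (Fin k ⊕ Fin r) (ZMod p)) (i : Fin k) (j : Fin r) :
    Matrix.reindex finSumFinEquiv finSumFinEquiv B (Fin.castAdd r i) (Fin.natAdd k j) = B (Sum.inl i) (Sum.inr j) := by
  simp [Matrix.reindex_apply]

omit [Fact p.Prime] in
/-- Entry `(natAdd i, castAdd j)` of a reindexed block matrix. -/
theorem reindex_apply_natAdd_castAdd (B : Matrix (Fin k ⊕ Fin r) (Fin k ⊕ Fin r) (ZMod p)) (i : Fin r) (j : Fin k) :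
    Matrix.reindex finSumFinEquiv finSumFinEquiv B (Fin.natAdd k i) (Fin.castAdd r j) = B (Sum.inr i) (Sum.inl j) := by
  simp [Matrix.reindex_apply]

omit [Fact p.Prime] in
/-- Entry `(natAdd i, natAdd j)` of a reindexed block matrix. -/
theorem reindex_apply_natAdd_natAdd (B : Matrix (Fin k ⊕ Fin r) (Fin k ⊕ Fin r) (ZMod p)) (i j : Fin r) :
    Matrix.reindex finSumFinEquiv finSumFinEquiv B (Fin.natAdd k i) (Fin.natAdd k j) = B (Sum.inr i) (Sum.inr j) := by
  simp [Matrix.reindex_apply]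

/-- `[[1,0],[X,t]]` satisfies the LOWER membership predicate of the rigid pair (skeleton
`Lines/levi_free_rigid_outer_pieces.lean`), hence lies in `H₁`. -/
theorem lowerGL_mem {T : Subgroup (GLm p r)} {H : Subgroup (GLm p (k + r))}
    (hH : ∀ g : GLm p (k + r), g ∈ H ↔
      ((∀ (i : Fin k) (j : Fin r), (g : Mat p (k + r)) (Fin.castAdd r i) (Fin.natAdd k j) = 0) ∧
        (∀ i : Fin k, (g : Mat p (k + r)) (Fin.castAdd r i) (Fin.castAdd r i) = 1) ∧
        (∀ i j : Fin k, i < j → (g : Mat p (k + r)) (Fin.castAdd r i) (Fin.castAdd r j) = 0) ∧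
        (∃ t ∈ T, ∀ i j : Fin r, (g : Mat p (k + r)) (Fin.natAdd k i) (Fin.natAdd k j) = (t : Mat p r) i j)))
    (X : Matrix (Fin r) (Fin k) (ZMod p)) {t : GLm p r} (ht : t ∈ T) : lowerGL X t ∈ H := by
  rw [hH]
  have hval : ((lowerGL X t : GLm p (k + r)) : Mat p (k + r)) =
      Matrix.reindex finSumFinEquiv finSumFinEquiv (Matrix.fromBlocks 1 0 X (t : Mat p r)) := rfl
  refine ⟨fun i j => ?_, fun i => ?_, fun i j hij => ?_, ⟨t, ht, fun i j => ?_⟩⟩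
  · rw [hval, reindex_apply_castAdd_natAdd, Matrix.fromBlocks_apply₁₂, Matrix.zero_apply]
  · rw [hval, reindex_apply_castAdd_castAdd, Matrix.fromBlocks_apply₁₁, Matrix.one_apply_eq]
  · rw [hval, reindex_apply_castAdd_castAdd, Matrix.fromBlocks_apply₁₁, Matrix.one_apply_ne (ne_of_lt hij)]
  · rw [hval, reindex_apply_natAdd_natAdd, Matrix.fromBlocks_apply₂₂]

/-- `[[1,Z],[0,t]]` satisfies the UPPER membership predicate of the rigid pair, hence lies in `H₃`. -/
theorem upperGL_mem {T : Subgroup (GLm p r)} {H : Subgroup (GLm p (k + r))}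
    (hH : ∀ g : GLm p (k + r), g ∈ H ↔
      ((∀ (i : Fin r) (j : Fin k), (g : Mat p (k + r)) (Fin.natAdd k i) (Fin.castAdd r j) = 0) ∧
        (∀ i : Fin k, (g : Mat p (k + r)) (Fin.castAdd r i) (Fin.castAdd r i) = 1) ∧
        (∀ i j : Fin k, j < i → (g : Mat p (k + r)) (Fin.castAdd r i) (Fin.castAdd r j) = 0) ∧
        (∃ t ∈ T, ∀ i j : Fin r, (g : Mat p (k + r)) (Fin.natAdd k i) (Fin.natAdd k j) = (t : Mat p r) i j)))
    (Z : Matrix (Fin k) (Fin r) (ZMod p)) {t : GLm p r} (ht : t ∈ T) : upperGL Z t ∈ H := by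
  rw [hH]
  have hval : ((upperGL Z t : GLm p (k + r)) : Mat p (k + r)) =
      Matrix.reindex finSumFinEquiv finSumFinEquiv (Matrix.fromBlocks 1 Z 0 (t : Mat p r)) := rfl
  refine ⟨fun i j => ?_, fun i => ?_, fun i j hij => ?_, ⟨t, ht, fun i j => ?_⟩⟩
  · rw [hval, reindex_apply_natAdd_castAdd, Matrix.fromBlocks_apply₂₁, Matrix.zero_apply]
  · rw [hval, reindex_apply_castAdd_castAdd, Matrix.fromBlocks_apply₁₁, Matrix.one_apply_eq]
  · rw [hval, reindex_apply_castAdd_castAdd, Matrix.fromBlocks_apply₁₁, Matrix.one_apply_ne (ne_of_gt hij)]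
  · rw [hval, reindex_apply_natAdd_natAdd, Matrix.fromBlocks_apply₂₂]

/-- Trace is invariant under reindexing by an equivalence. -/
theorem trace_reindex_eq {ι : Type*} [Fintype ι] (e : ι ≃ Fin (k + r)) (N : Matrix ι ι (ZMod p)) :
    Matrix.trace (Matrix.reindex e e N) = Matrix.trace N := by
  rw [Matrix.reindex_apply, Matrix.trace, Matrix.trace]
  exact Fintype.sum_equiv e.symm _ _ fun i => rfl

/-- Transport of the Fourier function along `Fin k ⊕ Fin r ≃ Fin (k + r)`:
`f_c(e B) = Σ_{M'} c(e M') ψ(tr(M' B))`. -/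
theorem fourier_reindex (c : Mat p (k + r) → ℂ) (B : Matrix (Fin k ⊕ Fin r) (Fin k ⊕ Fin r) (ZMod p)) :
    (∑ M : Mat p (k + r), c M * ZMod.stdAddChar (Matrix.trace (M * Matrix.reindex finSumFinEquiv finSumFinEquiv B))) =
      ∑ M' : Matrix (Fin k ⊕ Fin r) (Fin k ⊕ Fin r) (ZMod p),
        c (Matrix.reindex finSumFinEquiv finSumFinEquiv M') * ZMod.stdAddChar (Matrix.trace (M' * B)) := by
  refine Fintype.sum_equiv (Matrix.reindex finSumFinEquiv finSumFinEquiv).symm _ _ fun M => ?_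
  have hM : M = Matrix.reindex finSumFinEquiv finSumFinEquiv ((Matrix.reindex finSumFinEquiv finSumFinEquiv).symm M) :=
    ((Matrix.reindex finSumFinEquiv finSumFinEquiv).apply_symm_apply M).symm
  conv_lhs => rw [hM]
  congr 2
  rw [Matrix.reindex_apply, Matrix.reindex_apply, Matrix.submatrix_mul_equiv, ← Matrix.reindex_apply,
    trace_reindex_eq]

/-- **Crux form: a Levi collision in `T₁T₃` kills the identity test of the rigid pair for EVERY middle group.**
Let `H₁`, `H₃ ≤ GL_{k+r}(𝔽_p)` satisfy the lower/upper membership predicates of the rigid pair (skeleton of line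
`levi-free-rigid-outer-pieces`) for tori `T₁, T₃ ≤ GL_r(𝔽_p)`, and let `t₁ ∈ T₁`, `t₃ ∈ T₃` with `t₁t₃ ≠ 1` and
`γ (t₁t₃ - 1) β = 0` for a right-invertible `γ` and a left-invertible `β`.  Then for every `H₂` there is NO
rank-`≤ k` Fourier table `c` with `f_c(1) = 1` and `f_c(a b g) = 0` for `a ∈ H₁, b ∈ H₂, g ∈ H₃`, `abg ≠ 1` (the
identity-test clause of `SubgroupIdentityDesigns` / `stub_rigidDesigns`). -/
theorem rigidPair_no_idTest_of_leviCollision {T₁ T₃ : Subgroup (GLm p r)} {H₁ H₃ : Subgroup (GLm p (k + r))}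
    (hH₁ : ∀ g : GLm p (k + r), g ∈ H₁ ↔
      ((∀ (i : Fin k) (j : Fin r), (g : Mat p (k + r)) (Fin.castAdd r i) (Fin.natAdd k j) = 0) ∧
        (∀ i : Fin k, (g : Mat p (k + r)) (Fin.castAdd r i) (Fin.castAdd r i) = 1) ∧
        (∀ i j : Fin k, i < j → (g : Mat p (k + r)) (Fin.castAdd r i) (Fin.castAdd r j) = 0) ∧
        (∃ t ∈ T₁, ∀ i j : Fin r, (g : Mat p (k + r)) (Fin.natAdd k i) (Fin.natAdd k j) = (t : Mat p r) i j)))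
    (hH₃ : ∀ g : GLm p (k + r), g ∈ H₃ ↔
      ((∀ (i : Fin r) (j : Fin k), (g : Mat p (k + r)) (Fin.natAdd k i) (Fin.castAdd r j) = 0) ∧
        (∀ i : Fin k, (g : Mat p (k + r)) (Fin.castAdd r i) (Fin.castAdd r i) = 1) ∧
        (∀ i j : Fin k, j < i → (g : Mat p (k + r)) (Fin.castAdd r i) (Fin.castAdd r j) = 0) ∧
        (∃ t ∈ T₃, ∀ i j : Fin r, (g : Mat p (k + r)) (Fin.natAdd k i) (Fin.natAdd k j) = (t : Mat p r) i j)))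
    {t₁ t₃ : GLm p r} (ht₁ : t₁ ∈ T₁) (ht₃ : t₃ ∈ T₃) (hne : t₁ * t₃ ≠ 1)
    (γ : Matrix (Fin k) (Fin r) (ZMod p)) (β : Matrix (Fin r) (Fin k) (ZMod p))
    (γ' : Matrix (Fin r) (Fin k) (ZMod p)) (β' : Matrix (Fin k) (Fin r) (ZMod p))
    (hγ : γ * γ' = 1) (hβ : β' * β = 1) (hcol : γ * (((t₁ * t₃ : GLm p r) : Mat p r) - 1) * β = 0)
    (H₂ : Subgroup (GLm p (k + r))) :
    ¬ ∃ c : Mat p (k + r) → ℂ, RankSupp k c ∧ fourierFn c 1 = 1 ∧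
        ∀ a ∈ H₁, ∀ b ∈ H₂, ∀ g ∈ H₃, a * b * g ≠ 1 → fourierFn c (a * b * g) = 0 := by
  rintro ⟨c, hc, h1, h0⟩
  set e := (finSumFinEquiv : Fin k ⊕ Fin r ≃ Fin (k + r)) with he
  set t : Mat p r := ((t₁ * t₃ : GLm p r) : Mat p r) with ht
  have htne : t ≠ 1 := fun h => hne (Units.ext h)
  -- the set of (transported) products `a g`, `a ∈ H₁`, `g ∈ H₃`
  let S : Set (Matrix (Fin k ⊕ Fin r) (Fin k ⊕ Fin r) (ZMod p)) :=
    {B | ∃ a ∈ H₁, ∃ g ∈ H₃, Matrix.reindex e e B = ((a * g : GLm p (k + r)) : Mat p (k + r))}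
  have hSt : ∀ (X : Matrix (Fin r) (Fin k) (ZMod p)) (Z : Matrix (Fin k) (Fin r) (ZMod p)), blockPt X t Z ∈ S :=
    fun X Z => ⟨lowerGL X t₁, lowerGL_mem hH₁ X ht₁, upperGL Z t₃, upperGL_mem hH₃ Z ht₃,
      (lowerGL_mul_upperGL X Z t₁ t₃).symm⟩
  have hS1 : ∀ (X : Matrix (Fin r) (Fin k) (ZMod p)) (Z : Matrix (Fin k) (Fin r) (ZMod p)), blockPt X 1 Z ∈ S := by
    intro X Z
    refine ⟨lowerGL X 1, lowerGL_mem hH₁ X T₁.one_mem, upperGL Z 1, upperGL_mem hH₃ Z T₃.one_mem, ?_⟩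
    rw [lowerGL_mul_upperGL, mul_one, Units.val_one]
  -- the transported coefficient table
  let c' : Matrix (Fin k ⊕ Fin r) (Fin k ⊕ Fin r) (ZMod p) → ℂ := fun M' => c (Matrix.reindex e e M')
  have hc' : ∀ M', Fintype.card (Fin k) < M'.rank → c' M' = 0 := by
    intro M' hM'
    apply hc
    rw [Matrix.rank_reindex]
    simpa using hM'
  have h1' : (∑ M' : Matrix (Fin k ⊕ Fin r) (Fin k ⊕ Fin r) (ZMod p),
      c' M' * ZMod.stdAddChar (Matrix.trace (M' * 1))) = 1 := by
    have := fourier_reindex c 1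
    rw [Matrix.reindex_apply, Matrix.submatrix_one_equiv] at this
    rw [← this]
    exact h1
  have h0' : ∀ s ∈ S, s ≠ 1 → (∑ M' : Matrix (Fin k ⊕ Fin r) (Fin k ⊕ Fin r) (ZMod p),
      c' M' * ZMod.stdAddChar (Matrix.trace (M' * s))) = 0 := by
    rintro s ⟨a, ha, g, hg, hs⟩ hs1
    have hag : a * g ≠ 1 := by
      intro h
      apply hs1
      rw [h, Units.val_one] at hs
      have : s = (Matrix.reindex e e).symm 1 := by rw [← hs]; simp
      rw [this, Matrix.reindex_symm, Matrix.reindex_apply, Matrix.submatrix_one_equiv]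
    have h := h0 a ha 1 H₂.one_mem g hg (by rwa [mul_one])
    rw [mul_one] at h
    unfold fourierFn at h
    rw [← hs, fourier_reindex] at h
    exact h
  exact no_idTest_of_leviCollision γ β γ' β' hγ hβ t htne hcol S hSt hS1 c' hc' h1' h0'

/-- **The card's regime `r ≥ 2k` is dead.**  If `2k ≤ r` and `T₁` is non-trivial then the rigid pair admits NO
level-`k` identity test, whatever the middle group (every `t₁ ∈ T₁ ∖ 1` collides with `1`). In the parametrisation of
`stub_rigidDesigns` (`k = 2ℓ`, `r = ℓ n`, `|T₁| ≥ p^{ℓ-1} ≥ 2`) this excludes every `n ≥ 4`. -/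
theorem rigidPair_no_idTest_of_le {T₁ T₃ : Subgroup (GLm p r)} {H₁ H₃ : Subgroup (GLm p (k + r))}
    (hkr : 2 * k ≤ r)
    (hH₁ : ∀ g : GLm p (k + r), g ∈ H₁ ↔
      ((∀ (i : Fin k) (j : Fin r), (g : Mat p (k + r)) (Fin.castAdd r i) (Fin.natAdd k j) = 0) ∧
        (∀ i : Fin k, (g : Mat p (k + r)) (Fin.castAdd r i) (Fin.castAdd r i) = 1) ∧
        (∀ i j : Fin k, i < j → (g : Mat p (k + r)) (Fin.castAdd r i) (Fin.castAdd r j) = 0) ∧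
        (∃ t ∈ T₁, ∀ i j : Fin r, (g : Mat p (k + r)) (Fin.natAdd k i) (Fin.natAdd k j) = (t : Mat p r) i j)))
    (hH₃ : ∀ g : GLm p (k + r), g ∈ H₃ ↔
      ((∀ (i : Fin r) (j : Fin k), (g : Mat p (k + r)) (Fin.natAdd k i) (Fin.castAdd r j) = 0) ∧
        (∀ i : Fin k, (g : Mat p (k + r)) (Fin.castAdd r i) (Fin.castAdd r i) = 1) ∧
        (∀ i j : Fin k, j < i → (g : Mat p (k + r)) (Fin.castAdd r i) (Fin.castAdd r j) = 0) ∧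
        (∃ t ∈ T₃, ∀ i j : Fin r, (g : Mat p (k + r)) (Fin.natAdd k i) (Fin.natAdd k j) = (t : Mat p r) i j)))
    {t₁ : GLm p r} (ht₁ : t₁ ∈ T₁) (hne : t₁ ≠ 1) (H₂ : Subgroup (GLm p (k + r))) :
    ¬ ∃ c : Mat p (k + r) → ℂ, RankSupp k c ∧ fourierFn c 1 = 1 ∧
        ∀ a ∈ H₁, ∀ b ∈ H₂, ∀ g ∈ H₃, a * b * g ≠ 1 → fourierFn c (a * b * g) = 0 := by
  obtain ⟨γ, β, γ', β', hγ, hβ, hcol⟩ :=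
    exists_leviCollision_pair (F := ZMod p) hkr (((t₁ * 1 : GLm p r) : Mat p r) - 1)
  exact rigidPair_no_idTest_of_leviCollision hH₁ hH₃ ht₁ T₃.one_mem (by rwa [mul_one]) γ β γ' β' hγ hβ hcol H₂

end RigidPair

end Summit.MatrixMultiplication.MatrixMultiplication.Theorems.SubgroupIdentityDesigns.Negative

end
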